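import Summits.Parity.GeneralizedHardyLittlewood.Theorems.PrimeLevelFamEdgeMomentsBeyondDiagonalDiagRemBoseTwoSeq
import Summits.Parity.GeneralizedHardyLittlewood.Theorems.PrimeLevelFamEdgeMomentsBeyondDiagonalDiagRemMonomials
import Summits.Parity.GeneralizedHardyLittlewood.Theorems.PrimeLevelFamEdgeMomentsBeyondDiagonalDiagCornerProfileSum
import HarnessLib

/-!
# Route `PrimeLevelFamEdge`, crux K_A `MomentsBeyondDiagonal` (stmt-Parity-20007), line «petersson_layers» v4, stub `stub_diag`:
# **the inner `(k₁,k₂)` sum of the order-`(1,1)` remainder estimate (R), for fixed Selberg coordinates `(c,g)`**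

Fourth brick of (R) (hypothesis `hR` of `…DiagDecorOrderOneOneAssembly.orderOneOne_target_of_remainder`, p826053).
For `n = cg ≤ M`, `g ≤ M`, `Q, M ≥ 2`, `Y = M/n`, `α = g²/Q²`, threshold `K₁` with `2αK₁Y ≤ 1`, and the profile
coefficients `a_n = copTauW n` of `…DiagCornerProfileSum`:

`|Σ_{k₁,k₂≤Y} a_n(k₁)P(ℓ⁺₁/log M)·a_n(k₂)P(ℓ⁺₂/log M)·Wt(k₁,k₂)| ≤ C·D(n)·(Lam⁸√(2αK₁Y) + Lam¹⁰/(1+log K₁)¹²)`,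

`Lam = 1 + 2log M + log Q`, where `Wt` is the Hecke-summed remainder weight of order `(1,1)` written exactly as in (R)
(`L = 2(log Q − log g) − log k₁ − log k₂`, `X = L²/4 − (P₂(k₁)+P₂(k₂))/4`, remainders `c_ab(y) − Π_ab(log(1/y))` at
`y = αk₁k₂` with the constants of `…DiagRemBoseTwoSeq.abs_doubleSum_rem_le₂`).

* `abs_copTauW_le`, `abs_sum_copTauW_primeSq_le`, `sum_abs_copTauW_primeSq_ellp_pow_le` — the trivial bounds for the
  `P₂`-decorated column sequence (`≤ (1+log Y)⁴`, `≤ logʲY(1+log Y)⁴`; the elementary `P₂(k) ≤ log²k` is proved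
  inline — it is also `Literature.NumberTheory.Sieve.BombieriPr.sum_log_sq_primeFactors_le`, not imported here to keep the
  import closure of the `stub_diag` files inside `LFunctions`);
* `abs_inner_rem_le` — **the inner estimate** (via `…DiagRemMonomials.abs_profile_weight_le`).

Def-free; theorems only. Helper `--supports stmt-Parity-20007`; closes nothing; K_A, K_B and the Parity summit are NOT
proved; nothing about Landau–Siegel zeros.

## References
* E. Kowalski, P. Michel, J. VanderKam, J. reine angew. Math. 526 (2000), (22)–(28) pp. 12–15 and Prop. 5.1 p. 18.
  [cite: KowalskiMichelVanderKam2000, (23)–(28) and Prop. 5.1 — derivation (order-(1,1) remainder, inner sums)]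
-/

noncomputable section

open scoped Real ArithmeticFunction.Moebius
open Finset ArithmeticFunction Polynomial Real MeasureTheory

namespace Summit.Parity.GeneralizedHardyLittlewood.Theorems.MomentsBeyondDiagonal.DiagCorner

open Literature.NumberTheory.LFunctions Literature.NumberTheory.LFunctions.KMV2000
open MollifierMainTerm (W)
open Literature.Barriers.Parity (Icc_one_eq_Ioc_zero)
open Summit.Parity.GeneralizedHardyLittlewood.Theorems.BeyondDiagonalBeatsQuarter.KernelFormXSq
  (copTauW copTauW_apply divWeight divWeight_nonneg one_le_divWeight abs_W_le)
open Summit.Parity.GeneralizedHardyLittlewood.Theorems.BeyondDiagonalBeatsQuarter.Corner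

/-! ### Trivial bounds for the `P₂`-decorated column sequence -/

/-- `|a_n(k)| ≤ τ(k)/k`. [folklore] -/
theorem abs_copTauW_le (n k : ℕ) : |copTauW n k| ≤ (k.divisors.card : ℝ) / k := by
  rw [copTauW_apply]
  split_ifs
  · rw [abs_mul, abs_of_nonneg (by positivity : (0 : ℝ) ≤ k.divisors.card), div_eq_mul_inv]
    exact mul_le_mul_of_nonneg_left (abs_W_le k) (by positivity)
  · rw [abs_zero]; positivity

/-- `Σ_{k≤Y} (τ(k)/k)·P₂(k)·ℓ⁺(k)^m ≤ log^mY·(1+log Y)⁴` (`Y ≥ 1`). [folklore] -/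
theorem sum_tau_div_primeSq_ellp_pow_le (m : ℕ) {Y : ℝ} (hY : 1 ≤ Y) :
    ∑ k ∈ Icc 1 ⌊Y⌋₊, (k.divisors.card : ℝ) / k * (∑ p ∈ k.primeFactors, Real.log p ^ 2) * ellp Y k ^ m ≤
      Real.log Y ^ m * (1 + Real.log Y) ^ 4 := by
  have hY0 : 0 < Y := by linarith
  have hLY : 0 ≤ Real.log Y := Real.log_nonneg hY
  -- `P₂(k) ≤ log²k` (`Σ_{p∣k} log p = log ∏_{p∣k} p ≤ log k`, `log p ≤ log k`)
  have hP2k : ∀ k : ℕ, k ≠ 0 → ∑ p ∈ k.primeFactors, Real.log p ^ 2 ≤ Real.log k ^ 2 := by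
    intro k hk
    have hk1 : (1 : ℝ) ≤ k := by exact_mod_cast Nat.one_le_iff_ne_zero.2 hk
    have hlogk : 0 ≤ Real.log k := Real.log_nonneg hk1
    have hp : ∀ p ∈ k.primeFactors, 0 ≤ Real.log p ∧ Real.log p ≤ Real.log k := by
      intro p hp
      have hp' := (Nat.mem_primeFactors_of_ne_zero hk).1 hp
      have h2 : (2 : ℝ) ≤ p := by exact_mod_cast hp'.1.two_le
      exact ⟨Real.log_nonneg (by linarith),
        Real.log_le_log (by linarith) (by exact_mod_cast Nat.le_of_dvd (Nat.pos_of_ne_zero hk) hp'.2)⟩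
    have hsum : ∑ p ∈ k.primeFactors, Real.log p ≤ Real.log k := by
      have hprod : ((∏ p ∈ k.primeFactors, p : ℕ) : ℝ) ≤ k := by
        exact_mod_cast Nat.le_of_dvd (Nat.pos_of_ne_zero hk) (Nat.prod_primeFactors_dvd k)
      have hne : ∀ p ∈ k.primeFactors, (p : ℝ) ≠ 0 := fun p hp ↦ by
        exact_mod_cast (Nat.prime_of_mem_primeFactors hp).ne_zero
      have hpos : (0 : ℝ) < ((∏ p ∈ k.primeFactors, p : ℕ) : ℝ) := by
        rw [Nat.cast_prod]
        exact Finset.prod_pos fun p hp ↦ by exact_mod_cast (Nat.prime_of_mem_primeFactors hp).pos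
      rw [← Real.log_prod hne]
      have := Real.log_le_log hpos hprod
      rwa [Nat.cast_prod] at this
    calc ∑ p ∈ k.primeFactors, Real.log p ^ 2 ≤ ∑ p ∈ k.primeFactors, Real.log p * Real.log k := by
          refine Finset.sum_le_sum fun p hp' ↦ ?_
          rw [sq]
          exact mul_le_mul_of_nonneg_left (hp p hp').2 (hp p hp').1
      _ = (∑ p ∈ k.primeFactors, Real.log p) * Real.log k := by rw [Finset.sum_mul]
      _ ≤ Real.log k * Real.log k := mul_le_mul_of_nonneg_right hsum hlogk
      _ = Real.log k ^ 2 := by ring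
  have h1 : ∀ k ∈ Icc 1 ⌊Y⌋₊, (k.divisors.card : ℝ) / k * (∑ p ∈ k.primeFactors, Real.log p ^ 2) * ellp Y k ^ m ≤
      (k.divisors.card : ℝ) / k * (Real.log Y ^ 2 * Real.log Y ^ m) := by
    intro k hk
    have hk1 := (Finset.mem_Icc.1 hk).1
    have hkY : (k : ℝ) ≤ Y := by
      have := (Finset.mem_Icc.1 hk).2
      exact le_trans (by exact_mod_cast this) (Nat.floor_le hY0.le)
    have hk0 : k ≠ 0 := by omega
    have hlogk : Real.log k ≤ Real.log Y := Real.log_le_log (by exact_mod_cast hk1) hkY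
    have hlogk0 : 0 ≤ Real.log k := Real.log_nonneg (by exact_mod_cast hk1)
    have hP2 : ∑ p ∈ k.primeFactors, Real.log p ^ 2 ≤ Real.log Y ^ 2 :=
      (hP2k k hk0).trans (pow_le_pow_left₀ hlogk0 hlogk 2)
    have hl : ellp Y k ^ m ≤ Real.log Y ^ m := pow_le_pow_left₀ (ellp_nonneg Y k) (ellp_le_log hY hk1) m
    rw [mul_assoc]
    refine mul_le_mul_of_nonneg_left ?_ (by positivity)
    exact mul_le_mul hP2 hl (pow_nonneg (ellp_nonneg Y k) m) (by positivity)
  refine (Finset.sum_le_sum h1).trans ?_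
  rw [← Finset.sum_mul]
  have h2 : ∑ k ∈ Icc 1 ⌊Y⌋₊, (k.divisors.card : ℝ) / k ≤ (1 + Real.log ⌊Y⌋₊) ^ 2 := by
    rw [Icc_one_eq_Ioc_zero]
    exact Literature.NumberTheory.Sieve.Vaughan.sum_card_divisors_div_le ⌊Y⌋₊
  have h3 : (1 + Real.log ⌊Y⌋₊) ^ 2 ≤ (1 + Real.log Y) ^ 2 := by
    have hf1 : (1 : ℝ) ≤ ⌊Y⌋₊ := by exact_mod_cast Nat.le_floor (by simpa using hY)
    have : Real.log (⌊Y⌋₊ : ℝ) ≤ Real.log Y := Real.log_le_log (by linarith) (Nat.floor_le hY0.le)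
    have : 0 ≤ Real.log (⌊Y⌋₊ : ℝ) := Real.log_nonneg hf1
    nlinarith
  have h4 : Real.log Y ^ 2 ≤ (1 + Real.log Y) ^ 2 := pow_le_pow_left₀ hLY (by linarith) 2
  calc (∑ k ∈ Icc 1 ⌊Y⌋₊, (k.divisors.card : ℝ) / k) * (Real.log Y ^ 2 * Real.log Y ^ m)
      ≤ (1 + Real.log Y) ^ 2 * ((1 + Real.log Y) ^ 2 * Real.log Y ^ m) := by
        refine mul_le_mul (h2.trans h3) (mul_le_mul_of_nonneg_right h4 (pow_nonneg hLY m)) (by positivity)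
          (by positivity)
    _ = Real.log Y ^ m * (1 + Real.log Y) ^ 4 := by ring

/-- Partial sums of the `P₂`-decorated sequence: `|Σ_{k≤e} a_n(k)P₂(k)| ≤ (1+log Y)⁴` for `e ≤ ⌊Y⌋`, `Y ≥ 1`
(no cancellation needed: the decorated sequence sits on the column). [folklore] -/
theorem abs_sum_copTauW_primeSq_le (n : ℕ) {Y : ℝ} (hY : 1 ≤ Y) {e : ℕ} (he : e ≤ ⌊Y⌋₊) :
    |∑ k ∈ Icc 1 e, copTauW n k * ∑ p ∈ k.primeFactors, Real.log p ^ 2| ≤ (1 + Real.log Y) ^ 4 := by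
  have h := sum_tau_div_primeSq_ellp_pow_le 0 hY
  simp only [pow_zero, mul_one, one_mul] at h
  calc |∑ k ∈ Icc 1 e, copTauW n k * ∑ p ∈ k.primeFactors, Real.log p ^ 2|
      ≤ ∑ k ∈ Icc 1 e, |copTauW n k * ∑ p ∈ k.primeFactors, Real.log p ^ 2| := Finset.abs_sum_le_sum_abs _ _
    _ ≤ ∑ k ∈ Icc 1 ⌊Y⌋₊, |copTauW n k * ∑ p ∈ k.primeFactors, Real.log p ^ 2| :=
        Finset.sum_le_sum_of_subset_of_nonneg (Finset.Icc_subset_Icc_right he) fun _ _ _ ↦ abs_nonneg _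
    _ ≤ ∑ k ∈ Icc 1 ⌊Y⌋₊, (k.divisors.card : ℝ) / k * ∑ p ∈ k.primeFactors, Real.log p ^ 2 := by
        refine Finset.sum_le_sum fun k _ ↦ ?_
        have hP : 0 ≤ ∑ p ∈ k.primeFactors, Real.log p ^ 2 := Finset.sum_nonneg fun p _ ↦ sq_nonneg _
        rw [abs_mul, abs_of_nonneg hP]
        exact mul_le_mul_of_nonneg_right (abs_copTauW_le n k) hP
    _ ≤ (1 + Real.log Y) ^ 4 := h

/-- `Σ_{k≤Y} |a_n(k)P₂(k)|·ℓ⁺(k)^m ≤ log^mY·(1+log Y)⁴`. [folklore] -/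
theorem sum_abs_copTauW_primeSq_ellp_pow_le (n m : ℕ) {Y : ℝ} (hY : 1 ≤ Y) :
    ∑ k ∈ Icc 1 ⌊Y⌋₊, |copTauW n k * ∑ p ∈ k.primeFactors, Real.log p ^ 2| * ellp Y k ^ m ≤
      Real.log Y ^ m * (1 + Real.log Y) ^ 4 := by
  refine le_trans (Finset.sum_le_sum fun k _ ↦ ?_) (sum_tau_div_primeSq_ellp_pow_le m hY)
  have hP : 0 ≤ ∑ p ∈ k.primeFactors, Real.log p ^ 2 := Finset.sum_nonneg fun p _ ↦ sq_nonneg _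
  rw [abs_mul, abs_of_nonneg hP]
  exact mul_le_mul_of_nonneg_right (mul_le_mul_of_nonneg_right (abs_copTauW_le n k) hP)
    (pow_nonneg (ellp_nonneg Y k) m)

/-- `Σ_{k≤Y} |a_n(k)|·ℓ⁺(k)^m ≤ log^mY·(1+log Y)⁴` (weakening of `…CornerProfileSum.sum_abs_copTauW_mul_ellp_pow_le`).
[folklore] -/
theorem sum_abs_copTauW_ellp_pow_le₄ (n m : ℕ) {Y : ℝ} (hY : 1 ≤ Y) :
    ∑ k ∈ Icc 1 ⌊Y⌋₊, |copTauW n k| * ellp Y k ^ m ≤ Real.log Y ^ m * (1 + Real.log Y) ^ 4 := by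
  refine (sum_abs_copTauW_mul_ellp_pow_le n m hY).trans ?_
  have hLY : 0 ≤ Real.log Y := Real.log_nonneg hY
  have h : (1 + Real.log Y) ^ 2 ≤ (1 + Real.log Y) ^ 4 := pow_le_pow_right₀ (by linarith) (by norm_num)
  exact mul_le_mul_of_nonneg_left h (pow_nonneg hLY m)

/-! ### The inner estimate -/

set_option maxHeartbeats 800000 in
/-- **The inner `(k₁,k₂)` sum of the remainder estimate (R) for fixed `(c,g)`** (see the module docstring).
[cite: KowalskiMichelVanderKam2000, (23)–(28) and Prop. 5.1 — derivation (order-(1,1) remainder, inner sums)] -/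
theorem abs_inner_rem_le : ∃ E₀₀ E₀₁ E₁₀ E₁₁ μ₂ : ℝ, ∀ P : ℝ[X], P.coeff 0 = 0 → ∃ C : ℝ, 0 < C ∧
    ∀ (n g : ℕ), n ≠ 0 → g ≠ 0 → ∀ (Q M : ℝ), 2 ≤ Q → 2 ≤ M → (n : ℝ) ≤ M → (g : ℝ) ≤ M → ∀ K₁ : ℕ,
      2 * ((g : ℝ) ^ 2 / Q ^ 2) * K₁ * (M / n) ≤ 1 →
    |∑ k₁ ∈ Icc 1 ⌊M / n⌋₊, ∑ k₂ ∈ Icc 1 ⌊M / n⌋₊,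
        copTauW n k₁ * P.eval (ellp (M / n) k₁ / Real.log M) * (copTauW n k₂ * P.eval (ellp (M / n) k₂ / Real.log M)) *
          (((2 * (Real.log Q - Real.log g) - Real.log k₁ - Real.log k₂) ^ 2 / 4 -
              ((∑ p ∈ k₁.primeFactors, Real.log p ^ 2) + ∑ p ∈ k₂.primeFactors, Real.log p ^ 2) / 4) *
            ((∫ u₁ in Set.Ioi (0 : ℝ), ∫ u₂ in Set.Ioi (((g : ℝ) ^ 2 / Q ^ 2 * k₁ * k₂) / u₁),
                Real.exp (-(u₁ + u₂)) / (1 - Real.exp (-(u₁ + u₂))) ^ 2) -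
              (Real.log (1 / ((g : ℝ) ^ 2 / Q ^ 2 * k₁ * k₂)) / 2 + E₀₀)) +
          (2 * (Real.log Q - Real.log g) - Real.log k₁ - Real.log k₂) / 2 *
            (((∫ u₁ in Set.Ioi (0 : ℝ), ∫ u₂ in Set.Ioi (((g : ℝ) ^ 2 / Q ^ 2 * k₁ * k₂) / u₁),
                Real.exp (-(u₁ + u₂)) / (1 - Real.exp (-(u₁ + u₂))) ^ 2 * Real.log u₂) -
              (-(Real.log (1 / ((g : ℝ) ^ 2 / Q ^ 2 * k₁ * k₂)) ^ 2) / 8 + E₀₁)) +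
            ((∫ u₁ in Set.Ioi (0 : ℝ), Real.log u₁ * ∫ u₂ in Set.Ioi (((g : ℝ) ^ 2 / Q ^ 2 * k₁ * k₂) / u₁),
                Real.exp (-(u₁ + u₂)) / (1 - Real.exp (-(u₁ + u₂))) ^ 2) -
              (-(Real.log (1 / ((g : ℝ) ^ 2 / Q ^ 2 * k₁ * k₂)) ^ 2) / 8 + E₁₀))) +
          ((∫ u₁ in Set.Ioi (0 : ℝ), Real.log u₁ * ∫ u₂ in Set.Ioi (((g : ℝ) ^ 2 / Q ^ 2 * k₁ * k₂) / u₁),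
              Real.exp (-(u₁ + u₂)) / (1 - Real.exp (-(u₁ + u₂))) ^ 2 * Real.log u₂) -
            (Real.log (1 / ((g : ℝ) ^ 2 / Q ^ 2 * k₁ * k₂)) ^ 3 / 24 -
              2 * μ₂ * Real.log (1 / ((g : ℝ) ^ 2 / Q ^ 2 * k₁ * k₂)) + E₁₁)))| ≤
      C * divWeight n *
        ((1 + 2 * Real.log M + Real.log Q) ^ 10 * Real.sqrt (2 * ((g : ℝ) ^ 2 / Q ^ 2) * K₁ * (M / n)) +
          (1 + 2 * Real.log M + Real.log Q) ^ 10 / (1 + Real.log K₁) ^ 12) := by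
  obtain ⟨E₀₀, E₀₁, E₁₀, E₁₁, μ₂, C₀, hC₀, hrem⟩ := abs_doubleSum_rem_le₂
  obtain ⟨C₁, hC₁, hBu⟩ := abs_sum_copTauW_le'
  obtain ⟨C₂, hC₂, hAu⟩ := abs_sum_copTauW_le
  refine ⟨E₀₀, E₀₁, E₁₀, E₁₁, μ₂, fun P hP0 ↦ ?_⟩
  set SP : ℝ := ∑ i ∈ Finset.range (P.natDegree + 1), |P.coeff i| with hSP
  have hSP0 : 0 ≤ SP := Finset.sum_nonneg fun i _ ↦ abs_nonneg _
  -- the final constant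
  refine ⟨15 * SP ^ 2 * (3 * C₀ * (C₁ + 1) + 288 * C₀ * C₂) + 1, by positivity,
    fun n g hn hg Q M hQ2 hM2 hnM hgM K₁ hK₁ ↦ ?_⟩
  -- notation and basic facts
  have hn0 : (0 : ℝ) < n := by exact_mod_cast Nat.pos_of_ne_zero hn
  have hg0 : (0 : ℝ) < g := by exact_mod_cast Nat.pos_of_ne_zero hg
  have hg1 : (1 : ℝ) ≤ g := by exact_mod_cast Nat.one_le_iff_ne_zero.2 hg
  have hQ0 : 0 < Q := by linarith
  have hM0 : 0 < M := by linarith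
  set Y : ℝ := M / n with hYdef
  set L : ℝ := Real.log M with hLdef
  set α : ℝ := (g : ℝ) ^ 2 / Q ^ 2 with hαdef
  have hα : 0 < α := by positivity
  have hY : 1 ≤ Y := by rw [hYdef, le_div_iff₀ hn0]; linarith
  have hY0 : 0 < Y := by linarith
  have hYM : Y ≤ M := div_le_self hM0.le (by exact_mod_cast Nat.one_le_iff_ne_zero.2 hn)
  have hL0 : 0 < L := Real.log_pos (by linarith)
  have hLY0 : 0 ≤ Real.log Y := Real.log_nonneg hY
  have hLYL : Real.log Y ≤ L := Real.log_le_log hY0 hYM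
  have hlogQ : 0 ≤ Real.log Q := Real.log_nonneg (by linarith)
  have hlogg0 : 0 ≤ Real.log g := Real.log_nonneg hg1
  have hloggM : Real.log g ≤ L := Real.log_le_log hg0 hgM
  set Lam : ℝ := 1 + 2 * Real.log M + Real.log Q with hLamdef
  have hLam1 : 1 ≤ Lam := by rw [hLamdef]; linarith
  have hLam0 : 0 < Lam := by linarith
  set β : ℝ := Real.log Q - Real.log g - Real.log Y with hβdef
  have hβ : |β| ≤ Lam := by
    rw [hβdef, hLamdef, abs_le]; constructor <;> linarith
  have hLYLam : Real.log Y ≤ Lam := by rw [hLamdef]; linarith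
  have h1LY : 1 + Real.log Y ≤ Lam := by rw [hLamdef]; linarith
  have hD1 : 1 ≤ divWeight n := one_le_divWeight hn
  have hD0 : 0 ≤ divWeight n := divWeight_nonneg n
  -- `Lam' = 1 + |log(2αY²)| ≤ 2Lam`
  have hLam' : 1 + |Real.log (2 * α * Y ^ 2)| ≤ 2 * Lam := by
    have hl2 : Real.log 2 < 1 := by have := Real.log_two_lt_d9; linarith
    have hl2' : 0 < Real.log 2 := Real.log_pos (by norm_num)
    have hlog : Real.log (2 * α * Y ^ 2) = Real.log 2 + (2 * Real.log g - 2 * Real.log Q) + 2 * Real.log Y := by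
      rw [hαdef, Real.log_mul (by positivity) (by positivity), Real.log_mul (by norm_num) (by positivity),
        Real.log_pow, Real.log_div (by positivity) (by positivity), Real.log_pow, Real.log_pow]
      push_cast; ring
    rw [hlog, hLamdef]
    have := abs_le.2 (⟨by linarith, by linarith⟩ :
      -(1 + 4 * Real.log M + 2 * Real.log Q) ≤ Real.log 2 + (2 * Real.log g - 2 * Real.log Q) + 2 * Real.log Y ∧
        Real.log 2 + (2 * Real.log g - 2 * Real.log Q) + 2 * Real.log Y ≤ 1 + 4 * Real.log M + 2 * Real.log Q)
    linarith
  have hK0 : 0 ≤ Real.log (K₁ : ℝ) := Real.log_natCast_nonneg K₁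
  -- the envelope `Ψ`
  set Ψ : ℝ := divWeight n * (3 * C₀ * (C₁ + 1) * (1 + Real.log Y) ^ 8 * Real.sqrt (2 * α * K₁ * Y) +
      18 * C₀ * C₂ * (1 + Real.log Y) ^ 4 * (1 + |Real.log (2 * α * Y ^ 2)|) ^ 4 / (1 + Real.log K₁) ^ 12)
    with hΨdef
  have hΨ0 : 0 ≤ Ψ := by rw [hΨdef]; positivity
  -- partial-sum inputs for the row sequence `a_n`
  have hηe : ∀ e : ℕ, K₁ ≤ e → |∑ k ∈ Icc 1 e, copTauW n k| ≤ C₂ * divWeight n / (1 + Real.log K₁) ^ 12 := by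
    intro e he
    rcases Nat.eq_zero_or_pos e with rfl | he0
    · simp only [show Icc (1 : ℕ) 0 = ∅ from Finset.Icc_eq_empty (by norm_num), Finset.sum_empty, abs_zero]
      positivity
    · have h := hAu n hn (e : ℝ) (by exact_mod_cast he0)
      rw [Nat.floor_natCast] at h
      refine h.trans ?_
      have hle : Real.log (K₁ : ℝ) ≤ Real.log (e : ℝ) := by
        rcases Nat.eq_zero_or_pos K₁ with rfl | hK0'
        · simp only [Nat.cast_zero, Real.log_zero]; exact Real.log_natCast_nonneg e
        · exact Real.log_le_log (by exact_mod_cast hK0') (by exact_mod_cast he)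
      apply div_le_div_of_nonneg_left (by positivity) (by positivity)
      exact pow_le_pow_left₀ (by positivity) (by linarith) 12
  -- uniform bounds for the two column sequences (for `e ≤ ⌊Y⌋`)
  have hBa : ∀ e : ℕ, e ≤ ⌊Y⌋₊ → |∑ k ∈ Icc 1 e, copTauW n k| ≤ (C₁ + 1) * divWeight n * (1 + Real.log Y) ^ 4 := by
    intro e _
    have h1 : |∑ k ∈ Icc 1 e, copTauW n k| ≤ C₁ * divWeight n := by
      rcases Nat.eq_zero_or_pos e with rfl | he
      · simp only [show Icc (1 : ℕ) 0 = ∅ from Finset.Icc_eq_empty (by norm_num), Finset.sum_empty, abs_zero]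
        positivity
      · have := hBu n hn (e : ℝ) (by exact_mod_cast he)
        rwa [Nat.floor_natCast] at this
    have h4 : 1 ≤ (1 + Real.log Y) ^ 4 := one_le_pow₀ (by linarith)
    calc _ ≤ C₁ * divWeight n := h1
      _ ≤ (C₁ + 1) * divWeight n * 1 := by nlinarith
      _ ≤ (C₁ + 1) * divWeight n * (1 + Real.log Y) ^ 4 := by gcongr
  have hBaP : ∀ e : ℕ, e ≤ ⌊Y⌋₊ → |∑ k ∈ Icc 1 e, copTauW n k * ∑ p ∈ k.primeFactors, Real.log p ^ 2| ≤
      (C₁ + 1) * divWeight n * (1 + Real.log Y) ^ 4 := by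
    intro e he
    refine (abs_sum_copTauW_primeSq_le n hY he).trans ?_
    have : 1 ≤ (C₁ + 1) * divWeight n := by nlinarith
    have h4 : 0 ≤ (1 + Real.log Y) ^ 4 := by positivity
    nlinarith
  -- the per-monomial bound `hR`
  have hR : ∀ R : ℝ → ℝ,
      (R = (fun y ↦ (∫ u₁ in Set.Ioi (0 : ℝ), ∫ u₂ in Set.Ioi (y / u₁),
          Real.exp (-(u₁ + u₂)) / (1 - Real.exp (-(u₁ + u₂))) ^ 2) - (Real.log (1 / y) / 2 + E₀₀)) ∨
       R = (fun y ↦ (∫ u₁ in Set.Ioi (0 : ℝ), ∫ u₂ in Set.Ioi (y / u₁),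
          Real.exp (-(u₁ + u₂)) / (1 - Real.exp (-(u₁ + u₂))) ^ 2 * Real.log u₂) -
            (-(Real.log (1 / y) ^ 2) / 8 + E₀₁)) ∨
       R = (fun y ↦ (∫ u₁ in Set.Ioi (0 : ℝ), Real.log u₁ * ∫ u₂ in Set.Ioi (y / u₁),
          Real.exp (-(u₁ + u₂)) / (1 - Real.exp (-(u₁ + u₂))) ^ 2) - (-(Real.log (1 / y) ^ 2) / 8 + E₁₀)) ∨
       R = (fun y ↦ (∫ u₁ in Set.Ioi (0 : ℝ), Real.log u₁ * ∫ u₂ in Set.Ioi (y / u₁),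
          Real.exp (-(u₁ + u₂)) / (1 - Real.exp (-(u₁ + u₂))) ^ 2 * Real.log u₂) -
            (Real.log (1 / y) ^ 3 / 24 - 2 * μ₂ * Real.log (1 / y) + E₁₁))) →
      ∀ a₂ : ℕ → ℝ, (a₂ = ⇑(copTauW n) ∨ a₂ = fun k ↦ copTauW n k * (∑ p ∈ k.primeFactors, Real.log p ^ 2)) →
      ∀ i j : ℕ, 1 ≤ i → 1 ≤ j →
      |∑ k₁ ∈ Icc 1 ⌊Y⌋₊, ∑ k₂ ∈ Icc 1 ⌊Y⌋₊,
          copTauW n k₁ * a₂ k₂ * ellp Y k₁ ^ i * ellp Y k₂ ^ j * R (α * k₁ * k₂)| ≤ Real.log Y ^ (i + j) * Ψ := by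
    intro R hRR a₂ ha₂ i j hi hj
    -- data of the column sequence
    have hcol : (∀ e : ℕ, e ≤ ⌊Y⌋₊ → |∑ k ∈ Icc 1 e, a₂ k| ≤ (C₁ + 1) * divWeight n * (1 + Real.log Y) ^ 4) ∧
        ∑ k ∈ Icc 1 ⌊Y⌋₊, |a₂ k| * ellp Y k ^ j ≤ Real.log Y ^ j * (1 + Real.log Y) ^ 4 := by
      rcases ha₂ with rfl | rfl
      · exact ⟨hBa, sum_abs_copTauW_ellp_pow_le₄ n j hY⟩
      · exact ⟨hBaP, sum_abs_copTauW_primeSq_ellp_pow_le n j hY⟩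
    have hrow : ∑ k ∈ Icc 1 ⌊Y⌋₊, |copTauW n k| * ellp Y k ^ i ≤ Real.log Y ^ i * (1 + Real.log Y) ^ 4 :=
      sum_abs_copTauW_ellp_pow_le₄ n i hY
    have hm := hrem (copTauW n) a₂ Y α ((C₁ + 1) * divWeight n * (1 + Real.log Y) ^ 4)
      (C₂ * divWeight n / (1 + Real.log K₁) ^ 12) K₁ i j hY hα hi hj hcol.1 hηe hK₁
    -- the common envelope evaluates to `log^{i+j}Y · Ψ`
    have henv : (∑ k ∈ Icc 1 ⌊Y⌋₊, |copTauW n k| * ellp Y k ^ i) *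
          ((C₁ + 1) * divWeight n * (1 + Real.log Y) ^ 4 * (Real.log Y ^ j * (3 * C₀ * Real.sqrt (2 * α * K₁ * Y)))) +
        (∑ k ∈ Icc 1 ⌊Y⌋₊, |a₂ k| * ellp Y k ^ j) *
          ((2 * (C₂ * divWeight n / (1 + Real.log K₁) ^ 12)) *
            (Real.log Y ^ i * (9 * C₀ * (1 + |Real.log (2 * α * Y ^ 2)|) ^ 4))) ≤ Real.log Y ^ (i + j) * Ψ := by
      have hpos1 : 0 ≤ (C₁ + 1) * divWeight n * (1 + Real.log Y) ^ 4 *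
          (Real.log Y ^ j * (3 * C₀ * Real.sqrt (2 * α * K₁ * Y))) := by positivity
      have hpos2 : 0 ≤ (2 * (C₂ * divWeight n / (1 + Real.log K₁) ^ 12)) *
          (Real.log Y ^ i * (9 * C₀ * (1 + |Real.log (2 * α * Y ^ 2)|) ^ 4)) := by positivity
      have hK12 : (0 : ℝ) < (1 + Real.log K₁) ^ 12 := by positivity
      calc _ ≤ (Real.log Y ^ i * (1 + Real.log Y) ^ 4) *
            ((C₁ + 1) * divWeight n * (1 + Real.log Y) ^ 4 * (Real.log Y ^ j * (3 * C₀ * Real.sqrt (2 * α * K₁ * Y)))) +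
          (Real.log Y ^ j * (1 + Real.log Y) ^ 4) *
            ((2 * (C₂ * divWeight n / (1 + Real.log K₁) ^ 12)) *
              (Real.log Y ^ i * (9 * C₀ * (1 + |Real.log (2 * α * Y ^ 2)|) ^ 4))) :=
            add_le_add (mul_le_mul_of_nonneg_right hrow hpos1) (mul_le_mul_of_nonneg_right hcol.2 hpos2)
        _ = Real.log Y ^ (i + j) * Ψ := by
            rw [hΨdef, pow_add]
            field_simp
            ring
    -- rewrite the remainder, then apply the estimate
    rcases hRR with rfl | rfl | rfl | rfl
    · exact (hm.1).trans henv
    · exact (hm.2.1).trans henv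
    · exact (hm.2.2.1).trans henv
    · exact (hm.2.2.2).trans henv
  -- the weight in `β`-form
  have hLk : ∀ k₁ ∈ Icc 1 ⌊Y⌋₊, ∀ k₂ ∈ Icc 1 ⌊Y⌋₊,
      2 * (Real.log Q - Real.log g) - Real.log k₁ - Real.log k₂ = 2 * β + ellp Y k₁ + ellp Y k₂ := by
    intro k₁ hk₁ k₂ hk₂
    have h1 : (0 : ℝ) < k₁ := by exact_mod_cast (Finset.mem_Icc.1 hk₁).1
    have h2 : (0 : ℝ) < k₂ := by exact_mod_cast (Finset.mem_Icc.1 hk₂).1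
    rw [ellp_eq_log hY0.le hk₁, ellp_eq_log hY0.le hk₂, Real.log_div hY0.ne' h1.ne', Real.log_div hY0.ne' h2.ne',
      hβdef]
    ring
  have key := abs_profile_weight_le P hP0 hY hLam1 hβ hLYLam hΨ0 hL0 hLYL hR
  rw [Finset.sum_congr rfl fun k₁ hk₁ ↦ Finset.sum_congr rfl fun k₂ hk₂ ↦ by rw [hLk k₁ hk₁ k₂ hk₂]]
  refine key.trans ?_
  -- `15·SP²·Lam²·Ψ ≤ C·D(n)·Lam¹⁰·(√Y₁ + (1+log K₁)⁻¹²)`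
  have hsq : 0 ≤ Real.sqrt (2 * α * K₁ * Y) := Real.sqrt_nonneg _
  have hK12 : (0 : ℝ) < (1 + Real.log K₁) ^ 12 := by positivity
  have h8 : (1 + Real.log Y) ^ 8 ≤ Lam ^ 8 := pow_le_pow_left₀ (by linarith) h1LY 8
  have h4 : (1 + Real.log Y) ^ 4 ≤ Lam ^ 4 := pow_le_pow_left₀ (by linarith) h1LY 4
  have h4' : (1 + |Real.log (2 * α * Y ^ 2)|) ^ 4 ≤ (2 * Lam) ^ 4 := pow_le_pow_left₀ (by positivity) hLam' 4
  have hΨle : Ψ ≤ divWeight n * (3 * C₀ * (C₁ + 1) * Lam ^ 8 * Real.sqrt (2 * α * K₁ * Y) +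
      288 * C₀ * C₂ * Lam ^ 8 / (1 + Real.log K₁) ^ 12) := by
    rw [hΨdef]
    apply mul_le_mul_of_nonneg_left _ hD0
    apply add_le_add
    · have : 0 ≤ 3 * C₀ * (C₁ + 1) := by positivity
      exact mul_le_mul_of_nonneg_right (mul_le_mul_of_nonneg_left h8 this) hsq
    · rw [div_le_div_iff_of_pos_right hK12]
      have hLam4 : 0 ≤ Lam ^ 4 := by positivity
      calc 18 * C₀ * C₂ * (1 + Real.log Y) ^ 4 * (1 + |Real.log (2 * α * Y ^ 2)|) ^ 4
          ≤ 18 * C₀ * C₂ * Lam ^ 4 * (2 * Lam) ^ 4 := by gcongr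
        _ = 288 * C₀ * C₂ * Lam ^ 8 := by ring
  have hLam2 : 0 ≤ Lam ^ 2 := by positivity
  have hLam10 : 0 ≤ Lam ^ 10 := by positivity
  calc 15 * SP ^ 2 * Lam ^ 2 * Ψ
      ≤ 15 * SP ^ 2 * Lam ^ 2 * (divWeight n * (3 * C₀ * (C₁ + 1) * Lam ^ 8 * Real.sqrt (2 * α * K₁ * Y) +
          288 * C₀ * C₂ * Lam ^ 8 / (1 + Real.log K₁) ^ 12)) := mul_le_mul_of_nonneg_left hΨle (by positivity)
    _ = 15 * SP ^ 2 * (3 * C₀ * (C₁ + 1)) * divWeight n * (Lam ^ 10 * Real.sqrt (2 * α * K₁ * Y)) +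
        15 * SP ^ 2 * (288 * C₀ * C₂) * divWeight n * (Lam ^ 10 / (1 + Real.log K₁) ^ 12) := by
          ring
    _ ≤ (15 * SP ^ 2 * (3 * C₀ * (C₁ + 1) + 288 * C₀ * C₂) + 1) * divWeight n *
          (Lam ^ 10 * Real.sqrt (2 * α * K₁ * Y)) +
        (15 * SP ^ 2 * (3 * C₀ * (C₁ + 1) + 288 * C₀ * C₂) + 1) * divWeight n *
          (Lam ^ 10 / (1 + Real.log K₁) ^ 12) := by
          have p1 : 0 ≤ 15 * SP ^ 2 * (288 * C₀ * C₂) := by positivity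
          have p2 : 0 ≤ 15 * SP ^ 2 * (3 * C₀ * (C₁ + 1)) := by positivity
          have e1 : 15 * SP ^ 2 * (3 * C₀ * (C₁ + 1)) ≤ 15 * SP ^ 2 * (3 * C₀ * (C₁ + 1) + 288 * C₀ * C₂) + 1 := by
            linarith
          have e2 : 15 * SP ^ 2 * (288 * C₀ * C₂) ≤ 15 * SP ^ 2 * (3 * C₀ * (C₁ + 1) + 288 * C₀ * C₂) + 1 := by
            linarith
          gcongr
    _ = _ := by ring

end Summit.Parity.GeneralizedHardyLittlewood.Theorems.MomentsBeyondDiagonal.DiagCorner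

end
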